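import Summits.CriticalPhenomena.PercolationContinuityZ3.Theorems.PercNearOneGluingNoHeavyLowerTailKnQuestion8CoefficientwiseApex
import HarnessLib

/-!
# Resolution of the wall vertex's star (CW-PROGRAMME (P4)) for the coefficientwise first rung (prim-lf-2 gen 33)

Support file (`--supports stmt-CriticalPhenomena-4575`, closed), prover `prim-lf-2` (gen 33).  No definitions, no named facts, no sorries; standard axioms.
Memo `prim-lf-2/CW-LOCALITY-gen33.md` §3.1 and `prim-lf-2/CW-PROGRAMME-gen21.md` (P4).

For a finite edge set `E` on `V`, a root `x` and a wall vertex `z ≠ x`, split `E = E₀ ⊔ Ez` into the edges avoiding `z` and the edges at `z`.  A two-colouring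
`s = s₀ ⊔ t` (`s₀ ⊆ E₀`, `t ⊆ Ez`) lies in the wall `W_E = {z ∉ C_x(s), z ∉ C_x(E ∖ s)}` iff the non-`z` ends of the red `z`-edges `t` avoid `C_x(s₀)` and those of the
blue `z`-edges `Ez ∖ t` avoid `C_x(E₀ ∖ s₀)`, and then both clusters of `x` are those of `s₀`.  Hence for EVERY function `F` of the two clusters
  `Σ_{s ∈ W_E} F(C_x s, C_x(E∖s)) = Σ_{s₀ ⊆ E₀} N(s₀)·F(C_x s₀, C_x(E₀∖s₀))`,
`N(s₀)` = the number of compatible colourings of `Ez` (`Coefficientwise.wall_sum_zStar_resolution`), and if no edge joins `x` to `z`,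
`N(s₀) = ∏_{i ∈ Ez} (1[i's ends other than z avoid C_x s₀] + 1[… avoid C_x(E₀∖s₀)])` — the weight `∏_{v ∈ N(z)} (2 − a_v − b_v)` of CW-PROGRAMME (P4), with
multiplicities (`Coefficientwise.card_powerset_filter_split_eq_prod`, `Coefficientwise.wall_sum_zStar_prod`).  The first rung CW-PA(z) is thus a statement about the
UNCONDITIONED two-colourings of `G − z` weighted by `∏ (2 − a_v − b_v)`; the pendant theorem, z-locality of the point row (…PointLocality) and the avoidance-count
expansion of the point row (memo §3.1) are its first instances.
[cite: KozmaNitzan2024, Questions 8–9 (§5.5 p. 36) (context: the Question-8 pocket covariance programme)]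
-/

namespace Summit.CriticalPhenomena.PercolationContinuityZ3.Theorems

open Finset Literature.Probability.Percolation

namespace Coefficientwise

variable {ι V : Type*}

section counting

variable [DecidableEq ι]

/-- Subsets `t` of `A` with `P` on `t` and `Q` on `A ∖ t` are counted by `∏_{i∈A} ([P i] + [Q i])`. [cite: KozmaNitzan2024, §5.5 (context only; folklore)] -/
theorem card_powerset_filter_split_eq_prod (A : Finset ι) (P Q : ι → Prop) [DecidablePred P] [DecidablePred Q] :
    ((A.powerset.filter (fun t => (∀ i ∈ t, P i) ∧ (∀ i ∈ A \ t, Q i))).card : ℝ) =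
      ∏ i ∈ A, ((if P i then (1 : ℝ) else 0) + (if Q i then (1 : ℝ) else 0)) := by
  induction A using Finset.induction_on with
  | empty =>
    rw [Finset.prod_empty, Finset.powerset_empty, Finset.filter_true_of_mem]
    · simp
    · intro t ht
      rw [Finset.mem_singleton] at ht
      subst ht
      exact ⟨fun i hi => absurd hi (Finset.notMem_empty i), fun i hi => absurd hi (by simp)⟩
  | @insert e A heA ih =>
    rw [Finset.prod_insert heA, ← ih]
    -- split the subsets of `insert e A` along `e`
    have hsplit : (insert e A).powerset.filter (fun t => (∀ i ∈ t, P i) ∧ (∀ i ∈ (insert e A) \ t, Q i)) =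
        ((A.powerset.filter (fun t => (∀ i ∈ t, P i) ∧ (∀ i ∈ A \ t, Q i))).filter (fun _ => Q e)) ∪
        (((A.powerset.filter (fun t => (∀ i ∈ t, P i) ∧ (∀ i ∈ A \ t, Q i))).filter (fun _ => P e)).image (fun t => insert e t)) := by
      ext t
      simp only [Finset.mem_filter, Finset.mem_powerset, Finset.mem_union, Finset.mem_image]
      constructor
      · rintro ⟨ht, hP, hQ⟩
        by_cases het : e ∈ t
        · right
          refine ⟨t.erase e, ⟨⟨?_, ?_, ?_⟩, hP e het⟩, Finset.insert_erase het⟩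
          · intro i hi
            have hit : i ∈ t := Finset.mem_of_mem_erase hi
            have hine : i ≠ e := Finset.ne_of_mem_erase hi
            rcases Finset.mem_insert.mp (ht hit) with h | h
            · exact absurd h hine
            · exact h
          · exact fun i hi => hP i (Finset.mem_of_mem_erase hi)
          · intro i hi
            rw [Finset.mem_sdiff] at hi
            have hine : i ≠ e := fun h => heA (h ▸ hi.1)
            exact hQ i (Finset.mem_sdiff.mpr ⟨Finset.mem_insert_of_mem hi.1, fun h => hi.2 (Finset.mem_erase.mpr ⟨hine, h⟩)⟩)
        · left
          refine ⟨⟨?_, hP, ?_⟩, hQ e (Finset.mem_sdiff.mpr ⟨Finset.mem_insert_self e A, het⟩)⟩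
          · intro i hi
            rcases Finset.mem_insert.mp (ht hi) with h | h
            · exact absurd (h ▸ hi) het
            · exact h
          · intro i hi
            rw [Finset.mem_sdiff] at hi
            exact hQ i (Finset.mem_sdiff.mpr ⟨Finset.mem_insert_of_mem hi.1, hi.2⟩)
      · rintro (⟨⟨ht, hP, hQ⟩, hQe⟩ | ⟨t', ⟨⟨ht', hP', hQ'⟩, hPe⟩, rfl⟩)
        · refine ⟨fun i hi => Finset.mem_insert_of_mem (ht hi), hP, ?_⟩
          intro i hi
          rw [Finset.mem_sdiff, Finset.mem_insert] at hi
          rcases hi.1 with h | h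
          · exact h ▸ hQe
          · exact hQ i (Finset.mem_sdiff.mpr ⟨h, hi.2⟩)
        · refine ⟨Finset.insert_subset_insert e ht', ?_, ?_⟩
          · intro i hi
            rcases Finset.mem_insert.mp hi with h | h
            · exact h ▸ hPe
            · exact hP' i h
          · intro i hi
            rw [Finset.mem_sdiff, Finset.mem_insert, Finset.mem_insert, not_or] at hi
            rcases hi.1 with h | h
            · exact absurd h hi.2.1
            · exact hQ' i (Finset.mem_sdiff.mpr ⟨h, hi.2.2⟩)
    have hdisj : Disjoint ((A.powerset.filter (fun t => (∀ i ∈ t, P i) ∧ (∀ i ∈ A \ t, Q i))).filter (fun _ => Q e))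
        (((A.powerset.filter (fun t => (∀ i ∈ t, P i) ∧ (∀ i ∈ A \ t, Q i))).filter (fun _ => P e)).image (fun t => insert e t)) := by
      rw [Finset.disjoint_left]
      intro t ht ht'
      rw [Finset.mem_filter, Finset.mem_filter, Finset.mem_powerset] at ht
      obtain ⟨t', _, rfl⟩ := Finset.mem_image.mp ht'
      exact heA (ht.1.1 (Finset.mem_insert_self e t'))
    have hinj : Set.InjOn (fun t : Finset ι => insert e t)
        ↑((A.powerset.filter (fun t => (∀ i ∈ t, P i) ∧ (∀ i ∈ A \ t, Q i))).filter (fun _ => P e)) := by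
      intro t₁ ht₁ t₂ ht₂ h
      rw [Finset.mem_coe, Finset.mem_filter, Finset.mem_filter, Finset.mem_powerset] at ht₁ ht₂
      have he₁ : e ∉ t₁ := fun h' => heA (ht₁.1.1 h')
      have he₂ : e ∉ t₂ := fun h' => heA (ht₂.1.1 h')
      have := congrArg (fun s => Finset.erase s e) h
      simp only [Finset.erase_insert he₁, Finset.erase_insert he₂] at this
      exact this
    rw [hsplit, Finset.card_union_of_disjoint hdisj, Finset.card_image_of_injOn hinj, Finset.filter_const, Finset.filter_const]
    by_cases hPe : P e
    · by_cases hQe : Q e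
      · simp [hPe, hQe]; ring
      · simp [hPe, hQe]
    · by_cases hQe : Q e
      · simp [hPe, hQe]
      · simp [hPe, hQe]

end counting

section zstar

variable (ends : ι → Sym2 V)

open Classical in
/-- **Resolution of the star of the wall vertex** (CW-PROGRAMME (P4), general form).  Let `E` be a finite edge set, `x ≠ z`, `E₀ = {i ∈ E : z ∉ ends i}`,
`Ez = {i ∈ E : z ∈ ends i}`.  For every `F : Set V → Set V → ℝ`,
`Σ_{s ⊆ E : z ∉ C_x(s), z ∉ C_x(E∖s)} F(C_x s, C_x(E∖s)) = Σ_{s₀ ⊆ E₀} N(s₀) · F(C_x s₀, C_x(E₀∖s₀))` where `N(s₀)` is the number of `t ⊆ Ez` whose non-`z`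
ends avoid `C_x(s₀)` while those of `Ez ∖ t` avoid `C_x(E₀ ∖ s₀)` (the compatible colourings of the `z`-edges).  [cite: KozmaNitzan2024, Questions 8–9 (§5.5 p. 36) (context)] -/
theorem wall_sum_zStar_resolution (E : Finset ι) {x z : V} (hxz : z ≠ x) (F : Set V → Set V → ℝ) :
    ∑ s ∈ E.powerset.filter (fun s : Finset ι => z ∉ openCluster (ends '' (↑s : Set ι)) x ∧ z ∉ openCluster (ends '' (↑(E \ s) : Set ι)) x),
      F (openCluster (ends '' (↑s : Set ι)) x) (openCluster (ends '' (↑(E \ s) : Set ι)) x) =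
    ∑ s₀ ∈ (E.filter (fun i => z ∉ ends i)).powerset,
      (((E.filter (fun i => z ∈ ends i)).powerset.filter (fun t =>
          (∀ i ∈ t, ∀ v ∈ ends i, v ≠ z → v ∉ openCluster (ends '' (↑s₀ : Set ι)) x) ∧
          (∀ i ∈ (E.filter (fun i => z ∈ ends i)) \ t, ∀ v ∈ ends i, v ≠ z →
            v ∉ openCluster (ends '' (↑((E.filter (fun i => z ∉ ends i)) \ s₀) : Set ι)) x))).card : ℝ) *
        F (openCluster (ends '' (↑s₀ : Set ι)) x) (openCluster (ends '' (↑((E.filter (fun i => z ∉ ends i)) \ s₀) : Set ι)) x) := by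
  obtain ⟨Ez, hEz⟩ : ∃ Ez : Finset ι, Ez = E.filter (fun i => z ∈ ends i) := ⟨_, rfl⟩
  obtain ⟨E₀, hE₀⟩ : ∃ E₀ : Finset ι, E₀ = E.filter (fun i => z ∉ ends i) := ⟨_, rfl⟩
  rw [← hEz, ← hE₀]
  have hdisj : Disjoint E₀ Ez := by
    rw [hE₀, hEz, Finset.disjoint_filter]; exact fun i _ h => h
  have hEun : E = E₀ ∪ Ez := by
    rw [hE₀, hEz, Finset.union_comm]; exact (Finset.filter_union_filter_not_eq _ E).symm
  have hE₀z : ∀ i ∈ E₀, z ∉ ends i := fun i hi => by rw [hE₀, Finset.mem_filter] at hi; exact hi.2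
  have hEzz : ∀ i ∈ Ez, z ∈ ends i := fun i hi => by rw [hEz, Finset.mem_filter] at hi; exact hi.2
  rw [Finset.sum_filter, hEun, DualBHK.sum_powerset_union hdisj]
  refine Finset.sum_congr rfl fun s₀ hs₀ => ?_
  rw [Finset.mem_powerset] at hs₀
  have hs₀z : ∀ i ∈ s₀, z ∉ ends i := fun i hi => hE₀z i (hs₀ hi)
  have hbz : ∀ i ∈ E₀ \ s₀, z ∉ ends i := fun i hi => hE₀z i (Finset.sdiff_subset hi)
  have hzK : z ∉ openCluster (ends '' (↑s₀ : Set ι)) x := not_mem_openCluster_of_forall_not_mem ends hs₀z hxz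
  have hzKb : z ∉ openCluster (ends '' (↑(E₀ \ s₀) : Set ι)) x := not_mem_openCluster_of_forall_not_mem ends hbz hxz
  have hinner : ∀ t ∈ Ez.powerset,
      (if z ∉ openCluster (ends '' (↑(s₀ ∪ t) : Set ι)) x ∧ z ∉ openCluster (ends '' (↑((E₀ ∪ Ez) \ (s₀ ∪ t)) : Set ι)) x then
        F (openCluster (ends '' (↑(s₀ ∪ t) : Set ι)) x) (openCluster (ends '' (↑((E₀ ∪ Ez) \ (s₀ ∪ t)) : Set ι)) x) else 0) =
      if (∀ i ∈ t, ∀ v ∈ ends i, v ≠ z → v ∉ openCluster (ends '' (↑s₀ : Set ι)) x) ∧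
          (∀ i ∈ Ez \ t, ∀ v ∈ ends i, v ≠ z → v ∉ openCluster (ends '' (↑(E₀ \ s₀) : Set ι)) x) then
        F (openCluster (ends '' (↑s₀ : Set ι)) x) (openCluster (ends '' (↑(E₀ \ s₀) : Set ι)) x) else 0 := by
    intro t ht
    rw [Finset.mem_powerset] at ht
    have htz : ∀ i ∈ t, z ∈ ends i := fun i hi => hEzz i (ht hi)
    have hbtz : ∀ i ∈ Ez \ t, z ∈ ends i := fun i hi => hEzz i (Finset.sdiff_subset hi)
    rw [union_sdiff_union_of_subset hdisj hs₀ ht]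
    have h1 := not_mem_openCluster_union_zEdges_iff ends hs₀z hxz htz (x := x)
    have h2 := not_mem_openCluster_union_zEdges_iff ends hbz hxz hbtz (x := x)
    by_cases hc : (∀ i ∈ t, ∀ v ∈ ends i, v ≠ z → v ∉ openCluster (ends '' (↑s₀ : Set ι)) x) ∧
        (∀ i ∈ Ez \ t, ∀ v ∈ ends i, v ≠ z → v ∉ openCluster (ends '' (↑(E₀ \ s₀) : Set ι)) x)
    · rw [if_pos hc, if_pos ⟨h1.mpr hc.1, h2.mpr hc.2⟩, openCluster_union_zEdges_eq ends hzK hc.1, openCluster_union_zEdges_eq ends hzKb hc.2]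
    · rw [if_neg hc, if_neg (fun hW => hc ⟨h1.mp hW.1, h2.mp hW.2⟩)]
  rw [Finset.sum_congr rfl hinner, ← Finset.sum_filter, Finset.sum_const, nsmul_eq_mul]

open Classical in
/-- **(P4) with the product weight.**  If moreover no edge of `E` joins `x` to `z`, the number of compatible colourings of the `z`-edges factorises:
`Σ_{s ⊆ E : z ∉ C_x(s), z ∉ C_x(E∖s)} F(C_x s, C_x(E∖s)) = Σ_{s₀ ⊆ E₀} (∏_{i ∈ Ez} (1[no end v ≠ z of i lies in C_x s₀] + 1[no end v ≠ z of i lies in C_x(E₀∖s₀)])) · F(C_x s₀, C_x(E₀∖s₀))`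
— for a simple graph this is `Σ_{ω on G−z} ∏_{v ∈ N(z)} (2 − a_v − b_v) · F(K, K̄)` (CW-PROGRAMME (P4)); parallel `z`-edges contribute one factor each.
[cite: KozmaNitzan2024, Questions 8–9 (§5.5 p. 36) (context)] -/
theorem wall_sum_zStar_prod (E : Finset ι) {x z : V} (hxz : z ≠ x) (F : Set V → Set V → ℝ) :
    ∑ s ∈ E.powerset.filter (fun s : Finset ι => z ∉ openCluster (ends '' (↑s : Set ι)) x ∧ z ∉ openCluster (ends '' (↑(E \ s) : Set ι)) x),
      F (openCluster (ends '' (↑s : Set ι)) x) (openCluster (ends '' (↑(E \ s) : Set ι)) x) =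
    ∑ s₀ ∈ (E.filter (fun i => z ∉ ends i)).powerset,
      (∏ i ∈ E.filter (fun i => z ∈ ends i),
          ((if (∀ v ∈ ends i, v ≠ z → v ∉ openCluster (ends '' (↑s₀ : Set ι)) x) then (1 : ℝ) else 0) +
           (if (∀ v ∈ ends i, v ≠ z → v ∉ openCluster (ends '' (↑((E.filter (fun i => z ∉ ends i)) \ s₀) : Set ι)) x) then (1 : ℝ) else 0))) *
        F (openCluster (ends '' (↑s₀ : Set ι)) x) (openCluster (ends '' (↑((E.filter (fun i => z ∉ ends i)) \ s₀) : Set ι)) x) := by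
  rw [wall_sum_zStar_resolution ends E hxz F]
  refine Finset.sum_congr rfl fun s₀ _ => ?_
  congr 1
  exact card_powerset_filter_split_eq_prod (E.filter (fun i => z ∈ ends i))
    (fun i => ∀ v ∈ ends i, v ≠ z → v ∉ openCluster (ends '' (↑s₀ : Set ι)) x)
    (fun i => ∀ v ∈ ends i, v ≠ z → v ∉ openCluster (ends '' (↑((E.filter (fun i => z ∉ ends i)) \ s₀) : Set ι)) x)

end zstar

end Coefficientwise

end Summit.CriticalPhenomena.PercolationContinuityZ3.Theorems
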